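import Summits.RiemannHypothesis.RiemannHypothesis.Theorems.TiltedLandingLaw421R3Lens1ArcSignP

/-!
# TiltedLandingLaw421R3 — lens-1 (part Q): the LINK START LAW is a THEOREM; Jensen containment of the positive face

LENS-1 gen-8 module image `rh33346-cover/lens-1/JensenLink-v1.lean` (landing target `…/Theorems/TiltedLandingLaw421R3Lens1ArcSignQ.lean`; ONE import =
part P `…R3Lens1ArcSignP` (whose OPEN law it proves); namespace `RhW08.Lens1ArcSign`; 0 `sorry`; checked BY CHAIN over the tree part M with N and P
inlined).

§1–§2 ★★★ `linkStartLaw : LinkStartLawQ` — part Pʼs typed law PROVED: on a legal frame, at a SIMPLE upper zero `a` of `G = f^{(j)}` with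
`NoTallerToucher f j a`, `Im(G″(a)/G′(a)) ≤ −1/Im a`; i.e. `2·Im h₀ ≤ −1/Im a` for the link residue `h₀ = G″(a)/(2G′(a))`
(`two_mul_linkResidue_im_le`), so BOTH nodal chains of `Im(G′/G)` out of `a` enter aʼs Jensen disc at second order.  PROOF (no Hadamard expansion
needed — the treeʼs APPROXIMATE partial fractions suffice): remove the pair, `G = pairQ (Re a) (Im a) · h` (`RhW08.NestedSign.exists_cofactor`, `h` real
entire of order `< 2`, `h a ≠ 0` by simplicity); then `G′(a) = 2(a − Re a)·h(a)`, `G″(a) = 2h(a) + 4(a − Re a)·h′(a)`, so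
`G″(a)/G′(a) = 1/(a − Re a) + 2h′(a)/h(a)` and `Im(1/(a − Re a)) = −1/Im a`; finally `Im a · Im(h′/h)(a) ≤ 0` by the treeʼs JENSEN SIGN LEMMA
(`RhW08.NestedSign.im_mul_im_logDeriv_nonpos`) because `a` is strictly outside the Jensen disc of every zero of `h` — for zeros of height `≤ Im a` this is
automatic (`|Im z|² < (Re a − Re z)² + Im a²` unless `z ∈ {a, ā}`), for taller zeros (or their conjugates) it is exactly `NoTallerToucher`
(`im_sq_lt_of_otherZero`).  STRICT form `linkStart_strict_of_realEntireLt2` (`<` as soon as `f^{(j)}` has a zero other than `a, ā`, via the treeʼs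
`im_mul_im_logDeriv_neg`) — the lone pair is the only equality case, as in the finite model of part P.
§3 ★ JENSEN CONTAINMENT (`im_phi_neg_of_jensenClear`, `exists_jensenDisc_of_im_nonneg`, `exists_nonNestedDisc_of_exit`): at an upper point strictly outside
every Jensen disc `Im(G′/G) < 0`; hence every upper point of the CLOSED positive face `{Im(G′/G) ≥ 0}` — in particular every point of a nodal chain — lies in
the closed Jensen disc of some non-real zero, and a point of the face OUTSIDE aʼs closed disc lies in the disc of a zero `r ∉ {a, ā}` whose disc is NOT
nested in aʼs (`Im a < |Re a − Re r| + |Im r|`: a CROSSING or EXTERIOR zero; under `NoTallerToucher` never a taller one near `a`).  READING for the link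
(`TopLinkLawQ`, part N): a chain of `∂F_a` can leave aʼs closed Jensen disc only INTO the outer lune of a crossing / exterior-overlapping lower zero — the
exact event C6ʼs LINK TRACE records as XC/XD; with no such zero the disc clause of `HalfLink` is automatic.
NOT claimed: `TopLinkLawQ` / `AtomicLinkLawQ` (global), any atomic law, `TopPinning`.  Nothing here bears on the truth of RH; RH is not proved; 33346/33347 OPEN.
-/

noncomputable section

namespace RhW08.Lens1ArcSign

open Complex Set Metric Filter Topology
open scoped Real ComplexConjugate
open Literature.Topology.PlaneTopology Literature.Analysis.Complex
open Summit.RiemannHypothesis.RiemannHypothesis.Theorems.Splittings.JensenWindow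
open RhIdea6.G17.W07C7 RhIdea6.G17.W07C7.Rev6 RhIdea6.G18.W07C8.Law421BirthS RhIdea6.G19.W07C11.Seam
open RhIdea6.G20.W07C12.Frac RhIdea6.G20.W07C12.StColP RhW07.C12.FieldSplit RhIdea6.G21.W07C13.TentMax
open RhW07.C14.TwoSided RhW07.C14.Classes RhW07.C14.Lineage RhW07.C14.Booking
open RhW07.C13.Heredity RhIdea6.G22.W07C15pre.Injection RhW07.E3.Cell RhW07.E3.Lit
open RhW08.Round1 RhW08.StSwap RhW08.Round2 RhW08.QuadW RhW08.SealSwapQ RhW08.SealSwap RhW08.SuccB RhW08.SuccSplit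
open RhW08.SuccTheft RhW08.Column RhW08.Hurwitz RhW08.ClusterQ RhW08.ClusterQM RhW08.NewtonDoor RhW08.NewtonDoorGenusOne RhW08.PurseP
open RhW08.Lens1SignCut RhW08.Lens1Coverage RhW08.IsolatedTilt RhW08.Lens1Pinning RhW08.Lens1PinningIso


/-! ## §1 Jensen-clearness of a simple top among the other zeros -/

/-- Under `NoTallerToucher f j a` (`0 < Im a`, `f^{(j)}` real entire of order `< 2`), every zero `z ∉ {a, ā}` of `f^{(j)}` has `a` strictly outside its
Jensen disc: `Im z² < (Re a − Re z)² + Im a²` (height `≤ Im a`: automatic; taller `z` or `z̄`: the separation clause). -/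
theorem im_sq_lt_of_otherZero {f : ℂ → ℂ} {j : ℕ} {a z : ℂ} (hG : RealEntireLt2 (iteratedDeriv j f)) (hN : NoTallerToucher f j a)
    (ha : 0 < a.im) (hz : iteratedDeriv j f z = 0) (hza : z ≠ a) (hzb : z ≠ conj a) :
    z.im ^ 2 < (a.re - z.re) ^ 2 + a.im ^ 2 := by
  have hΔ : 0 ≤ (a.re - z.re) ^ 2 := sq_nonneg _
  by_cases h1 : a.im < z.im
  · have h := hN z hz h1
    have hlt : z.im < |a.re - z.re| := by linarith
    have key : z.im ^ 2 < |a.re - z.re| ^ 2 := sq_lt_sq' (by linarith [abs_nonneg (a.re - z.re)]) hlt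
    rw [sq_abs] at key
    nlinarith
  by_cases h2 : z.im < -a.im
  · have hz' : iteratedDeriv j f (conj z) = 0 := by rw [apply_conj_eq_conj hG.diff hG.real, hz, map_zero]
    have him : a.im < (conj z).im := by rw [Complex.conj_im]; linarith
    have h := hN (conj z) hz' him
    rw [Complex.conj_re, Complex.conj_im] at h
    have key : z.im ^ 2 < |a.re - z.re| ^ 2 := sq_lt_sq' (by linarith) (by linarith [abs_nonneg (a.re - z.re)])
    rw [sq_abs] at key
    nlinarith
  push Not at h1 h2
  by_cases h3 : z.re = a.re
  · have h4 : z.im ≠ a.im := fun h => hza (Complex.ext h3 h)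
    have h5 : z.im ≠ -a.im := by
      intro h
      apply hzb
      apply Complex.ext
      · rw [Complex.conj_re, h3]
      · rw [Complex.conj_im, h]
    have h6 : z.im < a.im := lt_of_le_of_ne h1 h4
    have h7 : -a.im < z.im := lt_of_le_of_ne h2 (Ne.symm h5)
    nlinarith [mul_pos (sub_pos.2 h6) (show 0 < a.im + z.im by linarith)]
  · have h8 : a.re - z.re ≠ 0 := fun h => h3 (by linarith)
    have h9 : 0 < (a.re - z.re) ^ 2 := by positivity
    nlinarith [mul_nonneg (sub_nonneg.2 h1) (show 0 ≤ a.im + z.im by linarith)]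

/-- The same as a Jensen-disc statement: `|Im z| < ‖a − Re z‖`. -/
theorem abs_im_lt_norm_of_otherZero {f : ℂ → ℂ} {j : ℕ} {a z : ℂ} (hG : RealEntireLt2 (iteratedDeriv j f)) (hN : NoTallerToucher f j a)
    (ha : 0 < a.im) (hz : iteratedDeriv j f z = 0) (hza : z ≠ a) (hzb : z ≠ conj a) :
    |z.im| < ‖a - (z.re : ℂ)‖ := by
  have hsq := im_sq_lt_of_otherZero hG hN ha hz hza hzb
  have e : ‖a - (z.re : ℂ)‖ ^ 2 = (a.re - z.re) ^ 2 + a.im ^ 2 := by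
    rw [← Complex.normSq_eq_norm_sq, Complex.normSq_apply]; simp; ring
  have h2 : |z.im| ^ 2 < ‖a - (z.re : ℂ)‖ ^ 2 := by rw [sq_abs, e]; exact hsq
  exact lt_of_pow_lt_pow_left₀ 2 (norm_nonneg _) h2

/-! ## §2 the LINK START LAW proved -/

/-- PAIR REMOVAL AT A SIMPLE TOP: `f^{(j)} = pairQ (Re a) (Im a) · h` with `h` real entire of order `< 2`, `h a ≠ 0`, `a` strictly outside every Jensen disc
of `h`, and `f^{(j+2)}(a)/f^{(j+1)}(a) = 1/(a − Re a) + 2·h′(a)/h(a)`. -/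
theorem linkStart_cofactor {f : ℂ → ℂ} (hf : RealEntireLt2 f) (j : ℕ) {a : ℂ} (ha : iteratedDeriv j f a = 0) (hapos : 0 < a.im)
    (hN : NoTallerToucher f j a) (hsimp : iteratedDeriv (j + 1) f a ≠ 0) :
    ∃ h : ℂ → ℂ, Differentiable ℂ h ∧ (∃ ρ C : ℝ, 0 ≤ ρ ∧ ρ < 2 ∧ ∀ z, ‖h z‖ ≤ C * Real.exp (‖z‖ ^ ρ)) ∧ (∀ x : ℝ, (h x).im = 0) ∧
      h a ≠ 0 ∧ (∀ z, iteratedDeriv j f z = pairQ a.re a.im z * h z) ∧ (∀ z, h z = 0 → |z.im| < ‖a - (z.re : ℂ)‖) ∧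
      iteratedDeriv (j + 2) f a / iteratedDeriv (j + 1) f a = (a - (a.re : ℂ))⁻¹ + (deriv h a / h a + deriv h a / h a) := by
  have hG : RealEntireLt2 (iteratedDeriv j f) := RhW08.WindowLoss.realEntireLt2_iteratedDeriv hf j
  obtain ⟨h, hhd, hgrow, hreal, hfac⟩ := RhW08.NestedSign.exists_cofactor hG ha hapos.ne'
  have eG : iteratedDeriv j f = pairQ a.re a.im * h := funext fun u => by rw [Pi.mul_apply]; exact hfac u
  have hq : ∀ z, HasDerivAt (pairQ a.re a.im) (2 * (z - a.re)) z :=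
    fun z => RhW07.Law421.SuccessorCertificate.hasDerivAt_quadP a.re a.im z
  have hderiv : ∀ z, deriv (iteratedDeriv j f) z = 2 * (z - a.re) * h z + pairQ a.re a.im z * deriv h z := by
    intro z
    have hp := (hq z).mul (hhd z).hasDerivAt
    rw [eG, hp.deriv]
  have hhd' : Differentiable ℂ (deriv h) :=
    Summit.RiemannHypothesis.RiemannHypothesis.Theorems.Splittings.JensenWindow.differentiable_deriv hhd
  have hderiv2 : ∀ z, deriv (deriv (iteratedDeriv j f)) z =
      2 * h z + 4 * (z - a.re) * deriv h z + pairQ a.re a.im z * deriv (deriv h) z := by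
    intro z
    have eG' : deriv (iteratedDeriv j f) = (fun z : ℂ => 2 * (z - a.re)) * h + pairQ a.re a.im * deriv h :=
      funext fun u => by simp only [Pi.add_apply, Pi.mul_apply]; exact hderiv u
    have hlin : HasDerivAt (fun z : ℂ => 2 * (z - a.re)) 2 z := by
      have h0 := ((hasDerivAt_id z).sub_const (a.re : ℂ)).const_mul (2 : ℂ)
      simpa using h0
    have hp := (hlin.mul (hhd z).hasDerivAt).add ((hq z).mul (hhd' z).hasDerivAt)
    rw [eG', hp.deriv]
    ring
  have hs1 : iteratedDeriv (j + 1) f = deriv (iteratedDeriv j f) := iteratedDeriv_succ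
  have hs2 : iteratedDeriv (j + 2) f = deriv (deriv (iteratedDeriv j f)) := by
    rw [show j + 2 = j + 1 + 1 from rfl, iteratedDeriv_succ, hs1]
  have e1 : a - (a.re : ℂ) = (a.im : ℂ) * I := by apply Complex.ext <;> simp
  have hqa : pairQ a.re a.im a = 0 := by
    rw [pairQ, e1, mul_pow, Complex.I_sq]; ring
  have hha : h a ≠ 0 := by
    intro h0; apply hsimp; rw [hs1, hderiv a, h0, hqa]; simp
  have hhabar : h (conj a) ≠ 0 := by rw [apply_conj_eq_conj hhd hreal, map_ne_zero]; exact hha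
  have hzero : ∀ z, h z = 0 → iteratedDeriv j f z = 0 := fun z hz => by rw [hfac z, hz, mul_zero]
  have hout : ∀ z, h z = 0 → |z.im| < ‖a - (z.re : ℂ)‖ := by
    intro z hz
    have hza : z ≠ a := by rintro rfl; exact hha hz
    have hzb : z ≠ conj a := by rintro rfl; exact hhabar hz
    exact abs_im_lt_norm_of_otherZero hG hN hapos (hzero z hz) hza hzb
  have hc : a - (a.re : ℂ) ≠ 0 := by
    rw [e1]; exact mul_ne_zero (Complex.ofReal_ne_zero.2 hapos.ne') Complex.I_ne_zero
  have hG1 : iteratedDeriv (j + 1) f a = 2 * (a - a.re) * h a := by rw [hs1, hderiv a, hqa, zero_mul, add_zero]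
  have hG2 : iteratedDeriv (j + 2) f a = 2 * h a + 4 * (a - a.re) * deriv h a := by
    rw [hs2, hderiv2 a, hqa, zero_mul, add_zero]
  refine ⟨h, hhd, hgrow, hreal, hha, hfac, hout, ?_⟩
  rw [hG1, hG2]
  field_simp
  ring

/-- `Im(1/(a − Re a)) = −1/Im a`. -/
theorem im_inv_sub_re (a : ℂ) (ha : a.im ≠ 0) : ((a - (a.re : ℂ))⁻¹).im = -1 / a.im := by
  have e1 : a - (a.re : ℂ) = (a.im : ℂ) * I := by apply Complex.ext <;> simp
  rw [e1, Complex.inv_im]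
  simp [Complex.normSq_apply]
  field_simp

/-- ★★ LINK START for a real entire `f` of order `< 2`: at a SIMPLE upper zero `a` of `f^{(j)}` with `NoTallerToucher f j a`,
`Im(f^{(j+2)}(a)/f^{(j+1)}(a)) ≤ −1/Im a`. -/
theorem linkStart_of_realEntireLt2 {f : ℂ → ℂ} (hf : RealEntireLt2 f) (j : ℕ) {a : ℂ} (ha : iteratedDeriv j f a = 0) (hapos : 0 < a.im)
    (hN : NoTallerToucher f j a) (hsimp : iteratedDeriv (j + 1) f a ≠ 0) :
    (iteratedDeriv (j + 2) f a / iteratedDeriv (j + 1) f a).im ≤ -1 / a.im := by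
  obtain ⟨h, hhd, ⟨ρ, C, hρ0, hρ, hgr⟩, hreal, hha, -, hout, hratio⟩ := linkStart_cofactor hf j ha hapos hN hsimp
  have hsign := RhW08.NestedSign.im_mul_im_logDeriv_nonpos hhd hρ0 hρ hgr hreal hha hout
  have hKim : (deriv h a / h a).im ≤ 0 := by
    by_contra hp
    push Not at hp
    have := mul_pos hapos hp
    linarith
  rw [hratio, Complex.add_im, Complex.add_im, im_inv_sub_re a hapos.ne']
  linarith

/-- `pairQ (Re a) (Im a) z = (z − a)(z − ā)`; hence it vanishes only at `a, ā`. -/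
theorem pairQ_ne_zero_of_ne {a z : ℂ} (hza : z ≠ a) (hzb : z ≠ conj a) : pairQ a.re a.im z ≠ 0 := by
  have e : pairQ a.re a.im z = (z - a) * (z - conj a) := by
    simp only [pairQ]
    apply Complex.ext
    · simp [sq, Complex.mul_re]; ring
    · simp [sq, Complex.mul_im]; ring
  rw [e]
  exact mul_ne_zero (sub_ne_zero.2 hza) (sub_ne_zero.2 hzb)

/-- ★ STRICT LINK START: if `f^{(j)}` has a zero other than `a, ā`, the inequality is strict (the lone pair is the only equality case). -/
theorem linkStart_strict_of_realEntireLt2 {f : ℂ → ℂ} (hf : RealEntireLt2 f) (j : ℕ) {a : ℂ} (ha : iteratedDeriv j f a = 0) (hapos : 0 < a.im)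
    (hN : NoTallerToucher f j a) (hsimp : iteratedDeriv (j + 1) f a ≠ 0)
    (hex : ∃ z, iteratedDeriv j f z = 0 ∧ z ≠ a ∧ z ≠ conj a) :
    (iteratedDeriv (j + 2) f a / iteratedDeriv (j + 1) f a).im < -1 / a.im := by
  obtain ⟨h, hhd, ⟨ρ, C, hρ0, hρ, hgr⟩, hreal, hha, hfac, hout, hratio⟩ := linkStart_cofactor hf j ha hapos hN hsimp
  obtain ⟨z, hz, hza, hzb⟩ := hex
  have hhz : h z = 0 := by
    have e := hfac z
    rw [hz] at e
    exact (mul_eq_zero.1 e.symm).resolve_left (pairQ_ne_zero_of_ne hza hzb)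
  have hclear : JensenClear h a := fun w hw _ => hout w hw
  have hsign := im_mul_im_logDeriv_neg hhd hρ0 hρ hgr hreal ⟨z, hhz⟩ hapos.ne' hclear
  have hKim : (deriv h a / h a).im < 0 := by
    by_contra hp
    push Not at hp
    have := mul_nonneg hapos.le hp
    linarith
  rw [hratio, Complex.add_im, Complex.add_im, im_inv_sub_re a hapos.ne']
  linarith

/-- ★★★ THE LINK START LAW (part P) IS A THEOREM. -/
theorem linkStartLaw : LinkStartLawQ := by
  intro η f x₀ s hmax R Hs B hE j a ha hapos hN hs
  exact linkStart_of_realEntireLt2 (realEntireLt2_of_hyps hE) j ha hapos hN hs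

/-- Hence unconditionally: `2·Im h₀ ≤ −1/Im a` for the link residue on every legal frame. -/
theorem two_mul_linkResidue_im_le {η : ℝ} {f : ℂ → ℂ} {x₀ s hmax R Hs : ℝ} {B : ℕ} (hE : EngineHyps5 2 η f x₀ s hmax R Hs B) {j : ℕ} {a : ℂ}
    (ha : iteratedDeriv j f a = 0) (hapos : 0 < a.im) (hN : NoTallerToucher f j a) (hs : iteratedDeriv (j + 1) f a ≠ 0) :
    2 * (linkResidue f j a).im ≤ -1 / a.im :=
  linkStartLaw_residue_form linkStartLaw hE ha hapos hN hs

/-! ## §3 Jensen containment of the closed positive face -/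

/-- ★ At an upper point strictly outside the Jensen disc of every non-real zero of `f^{(j)}` (which has at least one zero), `Im(f^{(j+1)}/f^{(j)}) < 0`. -/
theorem im_phi_neg_of_jensenClear {f : ℂ → ℂ} (hf : RealEntireLt2 f) (j : ℕ) {z : ℂ} (hz : 0 < z.im) (hex : ∃ r, iteratedDeriv j f r = 0)
    (hout : ∀ r, iteratedDeriv j f r = 0 → r.im ≠ 0 → |r.im| < ‖z - (r.re : ℂ)‖) :
    (iteratedDeriv (j + 1) f z / iteratedDeriv j f z).im < 0 := by
  have hG : RealEntireLt2 (iteratedDeriv j f) := RhW08.WindowLoss.realEntireLt2_iteratedDeriv hf j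
  obtain ⟨ρ, C, hρ0, hρ, hgr⟩ := hG.growth
  have h := im_mul_im_logDeriv_neg hG.diff hρ0 hρ hgr hG.real hex hz.ne' hout
  rw [← iteratedDeriv_succ] at h
  by_contra hp
  push Not at hp
  have := mul_nonneg hz.le hp
  linarith

/-- ★ JENSEN CONTAINMENT: every upper point of the closed positive face `{Im(f^{(j+1)}/f^{(j)}) ≥ 0}` lies in the CLOSED Jensen disc of some non-real zero. -/
theorem exists_jensenDisc_of_im_nonneg {f : ℂ → ℂ} (hf : RealEntireLt2 f) (j : ℕ) {z : ℂ} (hz : 0 < z.im) (hex : ∃ r, iteratedDeriv j f r = 0)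
    (hpos : 0 ≤ (iteratedDeriv (j + 1) f z / iteratedDeriv j f z).im) :
    ∃ r : ℂ, iteratedDeriv j f r = 0 ∧ r.im ≠ 0 ∧ ‖z - (r.re : ℂ)‖ ≤ |r.im| := by
  by_contra hno
  push Not at hno
  have h := im_phi_neg_of_jensenClear hf j hz hex fun r hr hri => hno r hr hri
  linarith

/-- The closed Jensen disc in coordinates: `‖z − Re r‖ ≤ |Im r| ↔ (Re z − Re r)² + Im z² ≤ Im r²`. -/
theorem norm_sub_re_le_iff (z r : ℂ) : ‖z - (r.re : ℂ)‖ ≤ |r.im| ↔ (z.re - r.re) ^ 2 + z.im ^ 2 ≤ r.im ^ 2 := by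
  have e : ‖z - (r.re : ℂ)‖ ^ 2 = (z.re - r.re) ^ 2 + z.im ^ 2 := by
    rw [← Complex.normSq_eq_norm_sq, Complex.normSq_apply]; simp; ring
  rw [← sq_abs r.im, ← e]
  exact (pow_le_pow_iff_left₀ (norm_nonneg _) (abs_nonneg _) two_ne_zero).symm

/-- ★ EXIT CLASSIFICATION: an upper point of the closed positive face OUTSIDE aʼs closed Jensen disc lies in the closed disc of a zero `r ∉ {a, ā}` whose disc is
NOT nested in aʼs (`Im a < |Re a − Re r| + |Im r|` — a crossing or exterior zero). -/
theorem exists_nonNestedDisc_of_exit {f : ℂ → ℂ} (hf : RealEntireLt2 f) (j : ℕ) {a z : ℂ} (ha : iteratedDeriv j f a = 0) (hz : 0 < z.im)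
    (hpos : 0 ≤ (iteratedDeriv (j + 1) f z / iteratedDeriv j f z).im) (hout : ¬ NestedStep a z) :
    ∃ r : ℂ, iteratedDeriv j f r = 0 ∧ r.im ≠ 0 ∧ r ≠ a ∧ r ≠ conj a ∧ ‖z - (r.re : ℂ)‖ ≤ |r.im| ∧ a.im < |a.re - r.re| + |r.im| := by
  obtain ⟨r, hr, hri, hzr⟩ := exists_jensenDisc_of_im_nonneg hf j hz ⟨a, ha⟩ hpos
  have hzr' := (norm_sub_re_le_iff z r).1 hzr
  have hra : r ≠ a := by
    rintro rfl; exact hout hzr'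
  have hrb : r ≠ conj a := by
    rintro rfl
    rw [Complex.conj_re, Complex.conj_im, neg_sq] at hzr'
    exact hout hzr'
  refine ⟨r, hr, hri, hra, hrb, hzr, ?_⟩
  by_contra hle
  push Not at hle
  have h1 : ‖z - (a.re : ℂ)‖ ≤ ‖z - (r.re : ℂ)‖ + ‖(r.re : ℂ) - (a.re : ℂ)‖ := norm_sub_le_norm_sub_add_norm_sub _ _ _
  have h2 : ‖(r.re : ℂ) - (a.re : ℂ)‖ = |a.re - r.re| := by
    rw [← Complex.ofReal_sub, Complex.norm_real, Real.norm_eq_abs, abs_sub_comm]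
  have h3 : ‖z - (a.re : ℂ)‖ ≤ |a.im| :=
    calc ‖z - (a.re : ℂ)‖ ≤ ‖z - (r.re : ℂ)‖ + ‖(r.re : ℂ) - (a.re : ℂ)‖ := h1
      _ ≤ |r.im| + |a.re - r.re| := by rw [h2]; linarith [hzr]
      _ ≤ a.im := by linarith
      _ ≤ |a.im| := le_abs_self _
  exact hout ((norm_sub_re_le_iff z a).1 h3)

end RhW08.Lens1ArcSign
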